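import Mathlib.Combinatorics.SetFamily.FourFunctions
import Mathlib.Combinatorics.SetFamily.HarrisKleitman
import HarnessLib

-- provenance: harness21/H21/H21/Statements/CritIsing/Wave0.lean @ fef268a (interim HEAD d8f2665); M5 mechanical rewrite
/-!
# Critical Ising family (`crit-ising`), wave 0

This file belongs to the statement library for the family `crit-ising` (peak: the 3-D
nearest-neighbour Ising model at `β_c` has a non-trivial, Möbius covariant scaling limit of its
spin correlations).

## Covered statement ids

* **crit-ising.S20** — the FKG / Holley / Ahlswede–Daykin four-functions inequalities on a finite
  distributive lattice, and the Harris–Kleitman correlation inequality for monotone families of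
  subsets of a finite set. All four are already theorems of Mathlib
  (`four_functions_theorem_univ`, `holley`, `fkg` in
  `Mathlib/Combinatorics/SetFamily/FourFunctions.lean`; `IsUpperSet.le_card_inter_finset`,
  `IsLowerSet.le_card_inter_finset` in `Mathlib/Combinatorics/SetFamily/HarrisKleitman.lean`), so
  the statements below are restated in the form of the inventory text and *proved* by direct appeal
  to the Mathlib anchors (no `sorry`).

## Skipped statement ids

* `crit-ising.S01`–`S19`, `S21`–`S25` : marked `statable_today: false` in the gap inventory
  (2026-08-12); they need the statistical-mechanics prelude (finite-volume Ising Gibbs measures,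
  `β_c`, lattice correlation functions, thermodynamic and scaling limits, the Möbius group of
  `ℝ^d ∪ {∞}`), none of which exists yet.

## Design choices

* The lattice inequalities are stated over an arbitrary commutative linearly ordered semiring `β`
  with `ExistsAddOfLE β` (the generality of Mathlib's `fkg`), which covers `ℝ`, `ℚ`, `ℝ≥0`, `ℕ`.
* "`Σ μ f`" in the informal text is rendered as `∑ a, μ a * f a` over a `Fintype` distributive
  lattice, exactly as in Mathlib.
* Harris–Kleitman is stated for the uniform (counting) measure on the power set `Finset α` of a
  `Fintype α`, in the multiplicative form `#𝒜 * #ℬ ≤ 2 ^ card α * #(𝒜 ∩ ℬ)` that avoids division.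

## References

* C. M. Fortuin, P. W. Kasteleyn, J. Ginibre, *Correlation inequalities on some partially ordered
  sets*, Comm. Math. Phys. 22 (1971) 89–103.
* R. Holley, *Remarks on the FKG inequalities*, Comm. Math. Phys. 36 (1974) 227–231.
* R. Ahlswede, D. E. Daykin, *An inequality for the weights of two families of sets, their unions
  and intersections*, Z. Wahrsch. Verw. Gebiete 43 (1978) 183–185.
* T. E. Harris (1960); D. J. Kleitman, *Families of non-disjoint subsets*, J. Comb. Theory 1 (1966).
-/

namespace Literature.Probability.LatticeModels

open Finset

section DistribLattice

variable {α β : Type*} [DistribLattice α] [Fintype α] [CommSemiring β] [LinearOrder β]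
  [IsStrictOrderedRing β] [ExistsAddOfLE β]

/-- **crit-ising.S20** (four-functions theorem; Ahlswede–Daykin, Z. Wahrsch. 43 (1978) 183;
Mathlib `four_functions_theorem_univ`).
On a finite distributive lattice `α`, if `f₁ f₂ f₃ f₄ : α → β` are nonnegative and
`f₁ a * f₂ b ≤ f₃ (a ⊓ b) * f₄ (a ⊔ b)` for all `a b`, then
`(∑ f₁) * (∑ f₂) ≤ (∑ f₃) * (∑ f₄)`. [folklore] -/
theorem four_functions (f₁ f₂ f₃ f₄ : α → β) (h₁ : 0 ≤ f₁) (h₂ : 0 ≤ f₂) (h₃ : 0 ≤ f₃)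
    (h₄ : 0 ≤ f₄) (h : ∀ a b, f₁ a * f₂ b ≤ f₃ (a ⊓ b) * f₄ (a ⊔ b)) :
    (∑ a, f₁ a) * ∑ a, f₂ a ≤ (∑ a, f₃ a) * ∑ a, f₄ a :=
  four_functions_theorem_univ f₁ f₂ f₃ f₄ h₁ h₂ h₃ h₄ h

/-- **crit-ising.S20** (Holley's inequality; Holley, Comm. Math. Phys. 36 (1974) 227;
Mathlib `holley`).
On a finite distributive lattice `α`, let `μ : α → β` be nonnegative and monotone and let
`f g : α → β` be nonnegative with equal total mass and satisfying the Holley condition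
`f a * g b ≤ f (a ⊓ b) * g (a ⊔ b)`. Then `∑ μ f ≤ ∑ μ g`, i.e. `g` stochastically dominates
`f`. [folklore] -/
theorem holley (μ f g : α → β) (hμ₀ : 0 ≤ μ) (hf : 0 ≤ f) (hg : 0 ≤ g) (hμ : Monotone μ)
    (hfg : ∑ a, f a = ∑ a, g a) (h : ∀ a b, f a * g b ≤ f (a ⊓ b) * g (a ⊔ b)) :
    ∑ a, μ a * f a ≤ ∑ a, μ a * g a :=
  _root_.holley f g μ hμ₀ hf hg hμ hfg h

/-- **crit-ising.S20** (FKG inequality; Fortuin–Kasteleyn–Ginibre, Comm. Math. Phys. 22 (1971)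
89; Mathlib `fkg`).
On a finite distributive lattice `α`, if `μ : α → β` is nonnegative and log-supermodular,
`μ a * μ b ≤ μ (a ⊓ b) * μ (a ⊔ b)`, and `f g : α → β` are nonnegative and monotone, then
`(∑ μ f) * (∑ μ g) ≤ (∑ μ) * (∑ μ f g)`: increasing observables are positively correlated
under `μ`. [folklore] -/
theorem fkg (μ f g : α → β) (hμ₀ : 0 ≤ μ) (hf₀ : 0 ≤ f) (hg₀ : 0 ≤ g) (hf : Monotone f)
    (hg : Monotone g) (hμ : ∀ a b, μ a * μ b ≤ μ (a ⊓ b) * μ (a ⊔ b)) :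
    (∑ a, μ a * f a) * ∑ a, μ a * g a ≤ (∑ a, μ a) * ∑ a, μ a * (f a * g a) :=
  _root_.fkg f g μ hμ₀ hf₀ hg₀ hf hg hμ

end DistribLattice

section HarrisKleitman

variable {α : Type*} [DecidableEq α] [Fintype α]

/-- **crit-ising.S20** (Harris–Kleitman inequality for up-sets; Harris 1960, Kleitman, J. Comb.
Theory 1 (1966); Mathlib `IsUpperSet.le_card_inter_finset`).
Any two up-sets `𝒜 ℬ` of the power set of a finite set `α` are positively correlated under the
uniform measure: `|𝒜| · |ℬ| ≤ 2 ^ |α| · |𝒜 ∩ ℬ|`, i.e. `P(𝒜) P(ℬ) ≤ P(𝒜 ∩ ℬ)`. [cite: Harris1960, Kleitman  J. Comb. Theory 1 (1966] -/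
theorem harris_kleitman_upperSet (𝒜 ℬ : Finset (Finset α))
    (h𝒜 : IsUpperSet (𝒜 : Set (Finset α))) (hℬ : IsUpperSet (ℬ : Set (Finset α))) :
    #𝒜 * #ℬ ≤ 2 ^ Fintype.card α * #(𝒜 ∩ ℬ) :=
  h𝒜.le_card_inter_finset hℬ

/-- **crit-ising.S20** (Harris–Kleitman inequality for down-sets; Harris 1960, Kleitman, J. Comb.
Theory 1 (1966); Mathlib `IsLowerSet.le_card_inter_finset`).
Any two down-sets `𝒜 ℬ` of the power set of a finite set `α` are positively correlated under the
uniform measure: `|𝒜| · |ℬ| ≤ 2 ^ |α| · |𝒜 ∩ ℬ|`. [cite: Harris1960, Kleitman  J. Comb. Theory 1 (1966] -/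
theorem harris_kleitman_lowerSet (𝒜 ℬ : Finset (Finset α))
    (h𝒜 : IsLowerSet (𝒜 : Set (Finset α))) (hℬ : IsLowerSet (ℬ : Set (Finset α))) :
    #𝒜 * #ℬ ≤ 2 ^ Fintype.card α * #(𝒜 ∩ ℬ) :=
  h𝒜.le_card_inter_finset hℬ

end HarrisKleitman

end Literature.Probability.LatticeModels
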